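import Summits.MatrixMultiplication.MatrixMultiplication.Theses.WindowedCompletionRank
import Literature.Computability.AlgebraicComplexity.FlatteningBound
import Literature.Computability.AlgebraicComplexity.TensorRestrictionRank
import Literature.RepresentationTheory.ModularTensorCategories.PointedModular

/-!
# Route `WindowedCompletionRank` — support `InvariantSqrtBound` (stmt-MatrixMultiplication-5501)

For `G = ℤ_n × ℤ_n` (`n ≥ 1`) and `S : G → G → G → ℂ` with the full-window data
`S(p+q; p, q) = [p₂ + q₁ = 0]`, invariant under `(g, p, q) ↦ (g + u + v, p + u, q + v)` for all
`u₂ + v₁ = 0`, one has `n ≤ R(S)²`.  Proof (the planner's sketch made precise):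

* the leg-wise DFT `Ŝ(α, β, γ) = ∑_{g,p,q} χ_α(g) χ_β(p) χ_γ(q) S(g,p,q)`,
  `χ_α(g) = e((α₁g₁ + α₂g₂)/n)`, is a restriction of `S` (`TensorRestrictsTo`), so `R(Ŝ) ≤ R(S)`;
* invariance: translating the summation variables multiplies `Ŝ(α,β,γ)` by the phase
  `χ_α(u+v) χ_β(u) χ_γ(v)`, so `Ŝ(α,β,γ) ≠ 0` forces `β₁ = -α₁`, `γ₂ = -α₂`, `γ₁ + α₁ = β₂ + α₂` —
  the support pattern `(x,y), (x,t), (y,t)` of a weighted matrix multiplication tensor;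
* data: by orthogonality of characters `∑_{x,y} Ŝ((x,y), (-x,k-y), (k-x,-y)) = n⁵ ≠ 0` for every
  `k ∈ ℤ_n`, so the support `F ⊆ ℤ_n³` (coordinates `(x, y, t)`) meets every class `x + y + t = k`,
  whence `n ≤ |F|`;
* flattenings: by the support pattern each `(β, γ)`-column (resp. `(α, γ)`-column) of `Ŝ` has at
  most one non-zero entry, so the non-zero `α`-slices (resp. `β`-slices) are linearly independent
  and their number is `≤ R(Ŝ)` (slice bound `card_le_tensorRank_of_linearIndependent` after
  restricting to those slices, and rotating for the second leg).  As `(x,y,t) ↦ ((x,y), (-x,t+x))`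
  is injective, `n ≤ |F| ≤ |π_{xy} F| · |π_{xt} F| ≤ R(Ŝ)² ≤ R(S)²`.

No named (unproved) fact is used; characters are Mathlib's `ZMod.stdAddChar` (orthogonality
`sum_stdAddChar_mul` is reused from `Literature/RepresentationTheory/ModularTensorCategories`).
References: Cohn–Umans 2003 (DFT of abelian group tensors); Bürgisser–Clausen–Shokrollahi 1997,
(14.8) / Bläser 2013, Lemma 7.1 (2) (slice lower bound).
-/

-- the summit-side namespace `Summit.MatrixMultiplication.MatrixMultiplication.…` repeats a component
set_option linter.dupNamespace false

noncomputable section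

namespace Summit.MatrixMultiplication.MatrixMultiplication.Theorems

open scoped BigOperators
open Literature.Computability.AlgebraicComplexity

namespace WindowedInvariantSqrt

variable {n : ℕ} [NeZero n]

/-- Counting: `∑_{q ∈ ℤ_n²} c·[t + q₁ = 0] = n·c` (the `q` with `q₁ = -t`). -/
theorem sum_ite_fst (t : ZMod n) (c : ℂ) :
    ∑ q : ZMod n × ZMod n, (if t + q.1 = 0 then c else 0) = n * c := by
  rw [← Finset.sum_filter, Finset.sum_const, nsmul_eq_mul]
  congr 1
  have hfilter : (Finset.univ.filter fun q : ZMod n × ZMod n => t + q.1 = 0) =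
      Finset.univ.image fun b : ZMod n => (-t, b) := by
    ext q
    simp only [Finset.mem_filter, Finset.mem_univ, true_and, Finset.mem_image]
    constructor
    · intro h
      exact ⟨q.2, Prod.ext (show -t = q.1 by linear_combination (-1 : ZMod n) * h) rfl⟩
    · rintro ⟨b, rfl⟩
      show t + -t = 0
      exact add_neg_cancel t
  rw [hfilter, Finset.card_image_of_injective _ (fun b b' h => (Prod.ext_iff.1 h).2),
    Finset.card_univ, ZMod.card]

/-- Translating the three summation variables of a triple sum over a finite additive group. -/
theorem sum_shift₃ {G M : Type*} [AddGroup G] [Fintype G] [AddCommMonoid M]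
    (Φ : G → G → G → M) (w u v : G) :
    ∑ g, ∑ p, ∑ q, Φ g p q = ∑ g, ∑ p, ∑ q, Φ (g + w) (p + u) (q + v) := by
  symm
  calc ∑ g, ∑ p, ∑ q, Φ (g + w) (p + u) (q + v)
      = ∑ g, ∑ p, ∑ q, Φ g (p + u) (q + v) :=
        Fintype.sum_bijective (· + w) (AddGroup.addRight_bijective w)
          (fun g => ∑ p, ∑ q, Φ (g + w) (p + u) (q + v)) (fun g => ∑ p, ∑ q, Φ g (p + u) (q + v))
          (fun _ => rfl)
    _ = ∑ g, ∑ p, ∑ q, Φ g p (q + v) :=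
        Finset.sum_congr rfl fun g _ => Fintype.sum_bijective (· + u)
          (AddGroup.addRight_bijective u) (fun p => ∑ q, Φ g (p + u) (q + v))
          (fun p => ∑ q, Φ g p (q + v)) (fun _ => rfl)
    _ = ∑ g, ∑ p, ∑ q, Φ g p q :=
        Finset.sum_congr rfl fun g _ => Finset.sum_congr rfl fun p _ =>
          Fintype.sum_bijective (· + v) (AddGroup.addRight_bijective v)
            (fun q => Φ g p (q + v)) (fun q => Φ g p q) (fun _ => rfl)

/-- Reordering a five-fold finite sum: the first two binders move inside the next three. -/
theorem sum_reorder₅ {M : Type*} [AddCommMonoid M] {α β γ δ ε : Type*} [Fintype α] [Fintype β]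
    [Fintype γ] [Fintype δ] [Fintype ε] (f : α → β → γ → δ → ε → M) :
    ∑ x, ∑ y, ∑ g, ∑ p, ∑ q, f x y g p q = ∑ p, ∑ q, ∑ g, ∑ x, ∑ y, f x y g p q := by
  calc ∑ x, ∑ y, ∑ g, ∑ p, ∑ q, f x y g p q
      = ∑ g, ∑ y, ∑ x, ∑ p, ∑ q, f x y g p q := sum_rev₃ (fun x y g => ∑ p, ∑ q, f x y g p q)
    _ = ∑ g, ∑ q, ∑ p, ∑ x, ∑ y, f x y g p q :=
        Finset.sum_congr rfl fun g _ => sum_rev₄ (fun y x p q => f x y g p q)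
    _ = ∑ p, ∑ q, ∑ g, ∑ x, ∑ y, f x y g p q := sum_rev₃ (fun g q p => ∑ x, ∑ y, f x y g p q)

/-! ### The leg-wise Fourier transform of an invariant completion -/

variable {χ : ZMod n × ZMod n → ZMod n × ZMod n → ℂ}
  {S H : ZMod n × ZMod n → ZMod n × ZMod n → ZMod n × ZMod n → ℂ}

/-- The characters `χ_α(g) = e((α₁ g₁ + α₂ g₂)/n)` of `ℤ_n²` are multiplicative in `g`. -/
theorem chi_add (hχ : ∀ α g, χ α g = ZMod.stdAddChar (α.1 * g.1 + α.2 * g.2))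
    (α a b : ZMod n × ZMod n) : χ α (a + b) = χ α a * χ α b := by
  rw [hχ, hχ, hχ, ← AddChar.map_add_eq_mul, Prod.fst_add, Prod.snd_add]
  congr 1
  ring

/-- Invariance of `S` under the translation by `(u + v, u, v)` multiplies `Ŝ(α, β, γ)` by the phase
`χ_α(u+v) χ_β(u) χ_γ(v)`. -/
theorem hat_eq_phase_mul (hχ : ∀ α g, χ α g = ZMod.stdAddChar (α.1 * g.1 + α.2 * g.2))
    (hH : ∀ α β γ, H α β γ = ∑ g, ∑ p, ∑ q, χ α g * χ β p * χ γ q * S g p q)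
    (hinv : ∀ g p q u v : ZMod n × ZMod n, u.2 + v.1 = 0 →
      S (g + (u + v)) (p + u) (q + v) = S g p q)
    (α β γ u v : ZMod n × ZMod n) (huv : u.2 + v.1 = 0) :
    H α β γ = (χ α (u + v) * χ β u * χ γ v) * H α β γ := by
  rw [hH]
  conv_lhs => rw [sum_shift₃ _ (u + v) u v]
  rw [Finset.mul_sum]
  refine Finset.sum_congr rfl fun g _ => ?_
  rw [Finset.mul_sum]
  refine Finset.sum_congr rfl fun p _ => ?_
  rw [Finset.mul_sum]
  refine Finset.sum_congr rfl fun q _ => ?_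
  rw [hinv g p q u v huv, chi_add hχ α g (u + v), chi_add hχ β p u, chi_add hχ γ q v]
  ring

/-- If `Ŝ(α, β, γ) ≠ 0` then every phase `α·(u+v) + β·u + γ·v` (`u₂ + v₁ = 0`) vanishes. -/
theorem phase_eq_zero (hχ : ∀ α g, χ α g = ZMod.stdAddChar (α.1 * g.1 + α.2 * g.2))
    (hH : ∀ α β γ, H α β γ = ∑ g, ∑ p, ∑ q, χ α g * χ β p * χ γ q * S g p q)
    (hinv : ∀ g p q u v : ZMod n × ZMod n, u.2 + v.1 = 0 →
      S (g + (u + v)) (p + u) (q + v) = S g p q)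
    {α β γ : ZMod n × ZMod n} (hne : H α β γ ≠ 0) (u₁ u₂ v₁ v₂ : ZMod n) (huv : u₂ + v₁ = 0) :
    α.1 * (u₁ + v₁) + α.2 * (u₂ + v₂) + (β.1 * u₁ + β.2 * u₂) + (γ.1 * v₁ + γ.2 * v₂) = 0 := by
  have h := hat_eq_phase_mul hχ hH hinv α β γ (u₁, u₂) (v₁, v₂) huv
  have hc : χ α ((u₁, u₂) + (v₁, v₂)) * χ β (u₁, u₂) * χ γ (v₁, v₂) = 1 :=
    mul_right_cancel₀ hne (h.symm.trans (one_mul _).symm)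
  rw [hχ, hχ, hχ, ← AddChar.map_add_eq_mul, ← AddChar.map_add_eq_mul, Prod.mk_add_mk,
    ← (ZMod.stdAddChar (N := n)).map_zero_eq_one] at hc
  exact ZMod.injective_stdAddChar hc

/-- **Support of the Fourier transform.** Invariance forces `Ŝ` to be supported on the
matrix-multiplication pattern `β₁ = -α₁`, `γ₂ = -α₂`, `γ₁ + α₁ = β₂ + α₂`. -/
theorem hat_support (hχ : ∀ α g, χ α g = ZMod.stdAddChar (α.1 * g.1 + α.2 * g.2))
    (hH : ∀ α β γ, H α β γ = ∑ g, ∑ p, ∑ q, χ α g * χ β p * χ γ q * S g p q)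
    (hinv : ∀ g p q u v : ZMod n × ZMod n, u.2 + v.1 = 0 →
      S (g + (u + v)) (p + u) (q + v) = S g p q)
    (α β γ : ZMod n × ZMod n) (hne : H α β γ ≠ 0) :
    β.1 = -α.1 ∧ γ.2 = -α.2 ∧ γ.1 + α.1 = β.2 + α.2 := by
  have h1 := phase_eq_zero hχ hH hinv hne 1 0 0 0 (by simp)
  have h2 := phase_eq_zero hχ hH hinv hne 0 0 0 1 (by simp)
  have h3 := phase_eq_zero hχ hH hinv hne 0 1 (-1) 0 (by simp)
  exact ⟨by linear_combination h1, by linear_combination h2,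
    by linear_combination (-1 : ZMod n) * h3⟩

/-- **Every class is hit.** The data `S(p+q; p, q) = [p₂ + q₁ = 0]` give, by orthogonality of
characters, `∑_{x,y} Ŝ((x,y), (-x,k-y), (k-x,-y)) = n⁵` for every `k`. -/
theorem hat_test_sum (hχ : ∀ α g, χ α g = ZMod.stdAddChar (α.1 * g.1 + α.2 * g.2))
    (hH : ∀ α β γ, H α β γ = ∑ g, ∑ p, ∑ q, χ α g * χ β p * χ γ q * S g p q)
    (hdata : ∀ p q : ZMod n × ZMod n, S (p + q) p q = if p.2 + q.1 = 0 then 1 else 0)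
    (k : ZMod n) :
    ∑ x : ZMod n, ∑ y : ZMod n, H (x, y) (-x, k - y) (k - x, -y) = (n : ℂ) ^ 5 := by
  -- (1) expand the phases: `χ_{(x,y)}(g) χ_{(-x,k-y)}(p) χ_{(k-x,-y)}(q)
  --     = e(x(g₁-p₁-q₁)/n) e(y(g₂-p₂-q₂)/n) e(k(p₂+q₁)/n)`
  have hexp : ∀ x y : ZMod n, H (x, y) (-x, k - y) (k - x, -y) =
      ∑ g : ZMod n × ZMod n, ∑ p : ZMod n × ZMod n, ∑ q : ZMod n × ZMod n,
        (ZMod.stdAddChar (x * (g.1 - p.1 - q.1)) : ℂ) *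
          (ZMod.stdAddChar (y * (g.2 - p.2 - q.2)) *
            (ZMod.stdAddChar (k * (p.2 + q.1)) * S g p q)) := by
    intro x y
    rw [hH]
    refine Finset.sum_congr rfl fun g _ => Finset.sum_congr rfl fun p _ =>
      Finset.sum_congr rfl fun q _ => ?_
    rw [hχ, hχ, hχ, ← mul_assoc, ← mul_assoc, ← AddChar.map_add_eq_mul, ← AddChar.map_add_eq_mul,
      ← AddChar.map_add_eq_mul, ← AddChar.map_add_eq_mul]
    congr 2
    dsimp only
    ring
  simp_rw [hexp]
  -- (2) bring the sums over `x, y` inside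
  rw [sum_reorder₅]
  -- (3) orthogonality in `x` and in `y`
  have hinner : ∀ (a b : ZMod n) (C : ℂ), ∑ x : ZMod n, ∑ y : ZMod n,
      (ZMod.stdAddChar (x * a) : ℂ) * (ZMod.stdAddChar (y * b) * C) =
      (if a = 0 then (n : ℂ) else 0) * ((if b = 0 then (n : ℂ) else 0) * C) := by
    intro a b C
    rw [← Literature.RepresentationTheory.ModularTensorCategories.sum_stdAddChar_mul a,
      ← Literature.RepresentationTheory.ModularTensorCategories.sum_stdAddChar_mul b,
      Finset.sum_mul, Finset.sum_mul]
    refine Finset.sum_congr rfl fun x _ => ?_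
    rw [Finset.mul_sum]
  simp only [hinner]
  -- (4) the sum over `g` collapses to `g = p + q`, where the data are prescribed
  have hg : ∀ p q : ZMod n × ZMod n,
      ∑ g : ZMod n × ZMod n, (if g.1 - p.1 - q.1 = 0 then (n : ℂ) else 0) *
        ((if g.2 - p.2 - q.2 = 0 then (n : ℂ) else 0) *
          (ZMod.stdAddChar (k * (p.2 + q.1)) * S g p q)) =
      if p.2 + q.1 = 0 then (n : ℂ) ^ 2 else 0 := by
    intro p q
    rw [Finset.sum_eq_single (p + q)]
    · have e1 : (p + q).1 - p.1 - q.1 = 0 := by rw [Prod.fst_add]; ring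
      have e2 : (p + q).2 - p.2 - q.2 = 0 := by rw [Prod.snd_add]; ring
      rw [if_pos e1, if_pos e2, hdata p q]
      by_cases h : p.2 + q.1 = 0
      · rw [if_pos h, if_pos h, h, mul_zero, AddChar.map_zero_eq_one]; ring
      · rw [if_neg h, if_neg h]; ring
    · intro g _ hg
      by_cases h1 : g.1 - p.1 - q.1 = 0
      · have h2 : ¬ (g.2 - p.2 - q.2 = 0) := fun h2 =>
          hg (Prod.ext (by rw [Prod.fst_add]; linear_combination h1)
            (by rw [Prod.snd_add]; linear_combination h2))
        rw [if_neg h2]; ring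
      · rw [if_neg h1]; ring
    · exact fun h => absurd (Finset.mem_univ _) h
  simp only [hg]
  -- (5) count the pairs `(p, q)` with `p₂ + q₁ = 0`
  simp only [sum_ite_fst, Finset.sum_const, Finset.card_univ, Fintype.card_prod, ZMod.card,
    nsmul_eq_mul]
  push_cast
  ring

/-- For every class `k` some `Ŝ((x,y), (-x,k-y), (k-x,-y))` is non-zero. -/
theorem hat_hit (hχ : ∀ α g, χ α g = ZMod.stdAddChar (α.1 * g.1 + α.2 * g.2))
    (hH : ∀ α β γ, H α β γ = ∑ g, ∑ p, ∑ q, χ α g * χ β p * χ γ q * S g p q)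
    (hdata : ∀ p q : ZMod n × ZMod n, S (p + q) p q = if p.2 + q.1 = 0 then 1 else 0)
    (k : ZMod n) : ∃ x y : ZMod n, H (x, y) (-x, k - y) (k - x, -y) ≠ 0 := by
  have hne : ∑ x : ZMod n, ∑ y : ZMod n, H (x, y) (-x, k - y) (k - x, -y) ≠ 0 := by
    rw [hat_test_sum hχ hH hdata k]
    exact pow_ne_zero _ (Nat.cast_ne_zero.2 (NeZero.ne n))
  obtain ⟨x, -, hx⟩ := Finset.exists_ne_zero_of_sum_ne_zero hne
  obtain ⟨y, -, hy⟩ := Finset.exists_ne_zero_of_sum_ne_zero hx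
  exact ⟨x, y, hy⟩

/-! ### Slice counting for a tensor with matrix-multiplication support -/

variable (T : ZMod n × ZMod n → ZMod n × ZMod n → ZMod n × ZMod n → ℂ)

/-- If every `(β, γ)`-column of `T` has at most one non-zero entry (as forced by the support
pattern), the non-zero `α`-slices are linearly independent: their number is at most `R(T)`. -/
theorem card_le_tensorRank_of_slices₁
    (hsupp : ∀ α β γ, T α β γ ≠ 0 → β.1 = -α.1 ∧ γ.2 = -α.2 ∧ γ.1 + α.1 = β.2 + α.2)
    (I : Finset (ZMod n × ZMod n)) (hI : ∀ a ∈ I, ∃ β γ, T a β γ ≠ 0) :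
    I.card ≤ tensorRank T := by
  classical
  have hres : TensorRestrictsTo T (fun (a : I) (b c : ZMod n × ZMod n) => T a b c) :=
    tensorRestrictsTo_precomp T (fun a : I => (a : ZMod n × ZMod n)) id id
  have hli : LinearIndependent ℂ (fun a : I => (fun b c : ZMod n × ZMod n => T a b c)) := by
    rw [Fintype.linearIndependent_iff]
    intro g hg a₀
    obtain ⟨β₀, γ₀, h₀⟩ := hI a₀ a₀.2
    have key := congr_fun (congr_fun hg β₀) γ₀
    rw [Finset.sum_apply, Finset.sum_apply, Finset.sum_eq_single a₀] at key
    · simp only [Pi.smul_apply, smul_eq_mul, Pi.zero_apply] at key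
      exact (mul_eq_zero.1 key).resolve_right h₀
    · intro a _ ha
      simp only [Pi.smul_apply, smul_eq_mul]
      refine mul_eq_zero.2 (Or.inr ?_)
      by_contra hT
      obtain ⟨h1, h2, -⟩ := hsupp _ _ _ hT
      obtain ⟨h1₀, h2₀, -⟩ := hsupp _ _ _ h₀
      exact ha (Subtype.ext (Prod.ext (neg_inj.1 (h1.symm.trans h1₀))
        (neg_inj.1 (h2.symm.trans h2₀))))
    · exact fun h => absurd (Finset.mem_univ _) h
  calc I.card = Fintype.card I := (Fintype.card_coe I).symm
    _ ≤ tensorRank (fun (a : I) (b c : ZMod n × ZMod n) => T a b c) :=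
        card_le_tensorRank_of_linearIndependent _ hli
    _ ≤ tensorRank T := hres.tensorRank_le

/-- The same count for the second leg: the non-zero `β`-slices are linearly independent, so their
number is at most `R(T)` (rotate the factors, then the slice bound). -/
theorem card_le_tensorRank_of_slices₂
    (hsupp : ∀ α β γ, T α β γ ≠ 0 → β.1 = -α.1 ∧ γ.2 = -α.2 ∧ γ.1 + α.1 = β.2 + α.2)
    (J : Finset (ZMod n × ZMod n)) (hJ : ∀ b ∈ J, ∃ α γ, T α b γ ≠ 0) :
    J.card ≤ tensorRank T := by
  classical
  have hres : TensorRestrictsTo T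
      (fun (a : ZMod n × ZMod n) (b : J) (c : ZMod n × ZMod n) => T a b c) :=
    tensorRestrictsTo_precomp T id (fun b : J => (b : ZMod n × ZMod n)) id
  have hli : LinearIndependent ℂ (fun b : J =>
      rotate (fun (a : ZMod n × ZMod n) (b : J) (c : ZMod n × ZMod n) => T a b c) b) := by
    rw [Fintype.linearIndependent_iff]
    intro g hg b₀
    obtain ⟨α₀, γ₀, h₀⟩ := hJ b₀ b₀.2
    have key := congr_fun (congr_fun hg γ₀) α₀
    rw [Finset.sum_apply, Finset.sum_apply, Finset.sum_eq_single b₀] at key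
    · simp only [Pi.smul_apply, smul_eq_mul, rotate_apply, Pi.zero_apply] at key
      exact (mul_eq_zero.1 key).resolve_right h₀
    · intro b _ hb
      simp only [Pi.smul_apply, smul_eq_mul, rotate_apply]
      refine mul_eq_zero.2 (Or.inr ?_)
      by_contra hT
      obtain ⟨h1, -, h3⟩ := hsupp _ _ _ hT
      obtain ⟨h1₀, -, h3₀⟩ := hsupp _ _ _ h₀
      exact hb (Subtype.ext (Prod.ext (h1.trans h1₀.symm)
        (add_right_cancel (h3.symm.trans h3₀))))
    · exact fun h => absurd (Finset.mem_univ _) h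
  calc J.card = Fintype.card J := (Fintype.card_coe J).symm
    _ ≤ tensorRank (rotate
          (fun (a : ZMod n × ZMod n) (b : J) (c : ZMod n × ZMod n) => T a b c)) :=
        card_le_tensorRank_of_linearIndependent _ hli
    _ = tensorRank (fun (a : ZMod n × ZMod n) (b : J) (c : ZMod n × ZMod n) => T a b c) :=
        tensorRank_rotate _
    _ ≤ tensorRank T := hres.tensorRank_le

/-- **The counting step.** A tensor with matrix-multiplication support whose support meets every
class `x + y + t = k` has `n ≤ R(T)²`: with `F` the support in coordinates `(x, y, t)`,
`n ≤ |F| ≤ |π_{xy} F| · |π_{xt} F| ≤ R(T) · R(T)`. -/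
theorem le_tensorRank_sq
    (hsupp : ∀ α β γ, T α β γ ≠ 0 → β.1 = -α.1 ∧ γ.2 = -α.2 ∧ γ.1 + α.1 = β.2 + α.2)
    (hhit : ∀ k : ZMod n, ∃ x y : ZMod n, T (x, y) (-x, k - y) (k - x, -y) ≠ 0) :
    n ≤ tensorRank T ^ 2 := by
  classical
  -- the support, in coordinates `(x, y, t)` ↦ `((x,y), (-x, t+x), (t+y, -y))`
  obtain ⟨F, hF⟩ : ∃ F : Finset (ZMod n × ZMod n × ZMod n), ∀ p, p ∈ F ↔
      T (p.1, p.2.1) (-p.1, p.2.2 + p.1) (p.2.2 + p.2.1, -p.2.1) ≠ 0 :=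
    ⟨Finset.univ.filter fun p => T (p.1, p.2.1) (-p.1, p.2.2 + p.1) (p.2.2 + p.2.1, -p.2.1) ≠ 0,
      fun p => by simp⟩
  -- `F` meets every class `x + y + t = k`
  have h1 : n ≤ F.card := by
    have hsub : (Finset.univ : Finset (ZMod n)) ⊆ F.image fun p => p.1 + p.2.1 + p.2.2 := by
      intro k _
      obtain ⟨x, y, hxy⟩ := hhit k
      refine Finset.mem_image.2 ⟨(x, y, k - x - y), (hF _).2 ?_, ?_⟩
      · have e1 : k - x - y + x = k - y := by ring
        have e2 : k - x - y + y = k - x := by ring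
        show T (x, y) (-x, k - x - y + x) (k - x - y + y, -y) ≠ 0
        rw [e1, e2]
        exact hxy
      · show x + y + (k - x - y) = k
        ring
    calc n = (Finset.univ : Finset (ZMod n)).card := by rw [Finset.card_univ, ZMod.card]
      _ ≤ (F.image fun p => p.1 + p.2.1 + p.2.2).card := Finset.card_le_card hsub
      _ ≤ F.card := Finset.card_image_le
  -- `|F| ≤ |π_{xy} F| · |π_{xt} F|`
  have h2 : F.card ≤ (F.image fun p => (p.1, p.2.1)).card *
      (F.image fun p => (-p.1, p.2.2 + p.1)).card := by
    have hinj : Function.Injective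
        fun p : ZMod n × ZMod n × ZMod n => ((p.1, p.2.1), (-p.1, p.2.2 + p.1)) := by
      rintro ⟨x, y, t⟩ ⟨x', y', t'⟩ h
      simp only [Prod.mk.injEq] at h
      obtain ⟨⟨rfl, rfl⟩, -, ht⟩ := h
      have htt : t = t' := by linear_combination ht
      rw [htt]
    calc F.card = (F.image fun p => ((p.1, p.2.1), (-p.1, p.2.2 + p.1))).card :=
          (Finset.card_image_of_injective F hinj).symm
      _ ≤ ((F.image fun p => (p.1, p.2.1)) ×ˢ (F.image fun p => (-p.1, p.2.2 + p.1))).card := by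
          refine Finset.card_le_card fun z hz => ?_
          obtain ⟨p, hp, rfl⟩ := Finset.mem_image.1 hz
          exact Finset.mem_product.2 ⟨Finset.mem_image_of_mem _ hp, Finset.mem_image_of_mem _ hp⟩
      _ = _ := Finset.card_product _ _
  -- the two projections are bounded by the rank
  have hI : ∀ a ∈ F.image (fun p => (p.1, p.2.1)), ∃ β γ, T a β γ ≠ 0 := by
    intro a ha
    obtain ⟨p, hp, rfl⟩ := Finset.mem_image.1 ha
    exact ⟨_, _, (hF p).1 hp⟩
  have hJ : ∀ b ∈ F.image (fun p => (-p.1, p.2.2 + p.1)), ∃ α γ, T α b γ ≠ 0 := by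
    intro b hb
    obtain ⟨p, hp, rfl⟩ := Finset.mem_image.1 hb
    exact ⟨_, _, (hF p).1 hp⟩
  calc n ≤ F.card := h1
    _ ≤ _ := h2
    _ ≤ tensorRank T * tensorRank T :=
        Nat.mul_le_mul (card_le_tensorRank_of_slices₁ T hsupp _ hI)
          (card_le_tensorRank_of_slices₂ T hsupp _ hJ)
    _ = tensorRank T ^ 2 := (sq _).symm

end WindowedInvariantSqrt

open WindowedInvariantSqrt in
/-- **`InvariantSqrtBound`** (route `WindowedCompletionRank`, item stmt-MatrixMultiplication-5501):
every translation-invariant completion `S` of the full-window data `S(p+q; p, q) = [p₂ + q₁ = 0]` on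
`(ℤ_n²)³` has `n ≤ R(S)²`.  Proof: the leg-wise Fourier transform `Ŝ` is a restriction of `S`
(`R(Ŝ) ≤ R(S)`), is supported on the matrix-multiplication pattern (`hat_support`), meets every
class (`hat_hit`), and such a tensor has `n ≤ R²` by slice counting (`le_tensorRank_sq`). -/
theorem invariantSqrtBound_proof :
    Summit.MatrixMultiplication.MatrixMultiplication.Theses.WindowedCompletionRank.InvariantSqrtBound := by
  intro n _ S hdata hinv
  -- the character table `χ` and the leg-wise Fourier transform `H = Ŝ`, by their defining equations
  obtain ⟨χ, hχ⟩ : ∃ χ : ZMod n × ZMod n → ZMod n × ZMod n → ℂ,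
      ∀ α g, χ α g = ZMod.stdAddChar (α.1 * g.1 + α.2 * g.2) := ⟨_, fun _ _ => rfl⟩
  obtain ⟨H, hH⟩ : ∃ H : ZMod n × ZMod n → ZMod n × ZMod n → ZMod n × ZMod n → ℂ,
      ∀ α β γ, H α β γ = ∑ g, ∑ p, ∑ q, χ α g * χ β p * χ γ q * S g p q := ⟨_, fun _ _ _ => rfl⟩
  have hres : TensorRestrictsTo S H := ⟨χ, χ, χ, hH⟩
  have hsq : n ≤ tensorRank H ^ 2 :=
    le_tensorRank_sq H (hat_support hχ hH hinv) (hat_hit hχ hH hdata)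
  exact hsq.trans (Nat.pow_le_pow_left hres.tensorRank_le 2)

end Summit.MatrixMultiplication.MatrixMultiplication.Theorems

end
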